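import Summits.CriticalPhenomena.PercolationContinuityZ3.Theorems.PercNearOneGluingNoHeavyLowerTailMajorityGluingHubOnlyWeakAt
import HarnessLib

/-!
# Majority gluing with loss `2·max` at `|A| = 6` and `|A| = 7` from the MAJORITY-OF-THREE percolation-EKR bound
# (lane prim-rate, constants-miner 1, gen 4 — the first two cells of the open window `6 ≤ |A| ≤ 55` reduced to `maj3`)

Support file for the closed crux `NoHeavyLowerTail` (stmt-CriticalPhenomena-4575; `--supports … --as helper`), continuing
`…MajorityGluingHubOnlyWeakAt.lean` (p317647: `WeakAt(A, a₀) ⟹ loss 2·max at A`).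

THE OBSERVATION (constants-miner 1, gen 4, `prim-rate-mine-1/CANDIDATES.md` §GEN-4 R16).  The window cells are monotone:
`{≥ h of the m relays of T cut from a₀} ⊆ {≥ h − 1 of any m − 1 of them cut}`.  At `|A| = 6` the cell is `(m, h) = (4, 3)`, at
`|A| = 7` it is `(5, 4)`; in both cases `h ≤ #cut T` leaves at most ONE relay of `T` joined to `a₀`, so every 3-subset `T' ⊆ T` has at
least two relays cut.  Hence the single hypothesis

  `Maj3(a₀)`: for every non-degenerate weight function `p` on the same vertex set, every 3-set `T' ∌ a₀` and every `0 ≤ δ ≤ 1/2`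
  bounding `μ_p(v ↮ a₀)` on `T'`:  `μ_p(2 ≤ #{v ∈ T' : v ↮ a₀}) ≤ δ`

(the majority-of-three case of the uniform percolation-EKR bound — 0 violations in every census of the lane, incl. Engine C's exact atlas
`run/shared/lean/ttrl/primrate/hub/README.md`; it is FALSE for hypergraph/site percolation, CANDIDATES §GEN-4 R18) gives `WeakAt(A, a₀)`
for `5 ≤ |A| ≤ 7` (`δ ≤ δ/(1−δ)`), and therefore, by p317647, **majority gluing with loss `2·max` at every relay set of size 5, 6 or 7**
(`HubOnly.majorityGluing_two_of_maj3`).  Sizes `≤ 5` are unconditional (`…MajorityGluing.lean`, p308121); `|A| = 8` would need the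
`(6,4)` cell, which `maj3` does not imply.  Also recorded, as pure real arithmetic on the eight atoms of a three-relay cut law
(`HubOnly.maj3_exchange_of_c1star`): the mined quadratic exchange inequality (C1*) `p₀₁₁·p₁₀₁ ≤ p₁₀₀·p₀₁₀` together with
`δ₁ ≥ δ₂` yields the exchange form `p₀₁₁ ≤ p₁₀₀` of `maj3` (CANDIDATES §GEN-4 R17).  No definitions, no named facts, no sorries.
[cite: KozmaNitzan2024, Conj. 1 (p. 3), Conj. 4 (p. 32)]
-/

noncomputable section

namespace Summit.CriticalPhenomena.PercolationContinuityZ3.Theorems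

open MeasureTheory Set
open Literature.Probability.LatticeModels (prodBernoulli)
open Literature.Probability.Percolation
open scoped Classical

namespace HubOnly

variable {n : ℕ}

/-- **Monotonicity of the window cells (counting core).** If `T' ⊆ T`, `|T'| = 3` and at most one relay of `T` is joined
(`|T| ≤ #cut T + 1`), then at least two relays of `T'` are cut.  Pure finset counting. [folklore] -/
theorem two_le_card_filter_of_subset {α : Type*} [DecidableEq α] (T T' : Finset α) (P : α → Prop) [DecidablePred P]
    (hsub : T' ⊆ T) (hT' : T'.card = 3) (hcut : T.card ≤ (T.filter P).card + 1) :
    2 ≤ (T'.filter P).card := by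
  have h1 := Finset.card_filter_add_card_filter_not (s := T) P
  have h2 := Finset.card_filter_add_card_filter_not (s := T') P
  have h3 : (T'.filter fun x => ¬ P x).card ≤ (T.filter fun x => ¬ P x).card :=
    Finset.card_le_card (Finset.filter_subset_filter _ hsub)
  omega

/-- **`Maj3(a₀) ⟹ WeakAt(A, a₀)` for `5 ≤ |A| ≤ 7`.**  With `|T| + 2 = |A|` and threshold `⌈|A|/2⌉ = (|A|+1)/2`, the event
`{⌈|A|/2⌉ ≤ #cut T}` leaves at most one relay of `T` joined; any 3-subset `T' ⊆ T` then has `≥ 2` cut relays, so the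
majority-of-three bound `μ(2 ≤ #cut T') ≤ δ` and `δ ≤ δ/(1−δ)` (`0 ≤ δ ≤ 1/2`) give the weak bound at the single size the kernel
chain consumes. [cite: KozmaNitzan2024, Conj. 4 (p. 32)] -/
theorem weakEKR_at_of_maj3 (A : Finset (Fin n)) (a₀ : Fin n) (h5 : 5 ≤ A.card) (h7 : A.card ≤ 7)
    (hM : ∀ (p : Sym2 (Fin n) → unitInterval), (∀ e, 0 < p e ∧ p e < 1) →
      ∀ (T' : Finset (Fin n)) (δ : ℝ), a₀ ∉ T' → T'.card = 3 → 0 ≤ δ → δ ≤ 1 / 2 →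
      (∀ v ∈ T', (prodBernoulli p).real (openConn v a₀ : Set (BondConfig (Fin n)))ᶜ ≤ δ) →
      (prodBernoulli p).real {ω : BondConfig (Fin n) | 2 ≤ (T'.filter fun v => ω ∉ openConn v a₀).card} ≤ δ) :
    ∀ (p : Sym2 (Fin n) → unitInterval), (∀ e, 0 < p e ∧ p e < 1) →
      ∀ (T : Finset (Fin n)) (δ : ℝ), a₀ ∉ T → T ⊆ A → T.card + 2 = A.card → 0 ≤ δ → δ ≤ 1 / 2 →
      (∀ v ∈ T, (prodBernoulli p).real (openConn v a₀ : Set (BondConfig (Fin n)))ᶜ ≤ δ) →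
      (prodBernoulli p).real {ω : BondConfig (Fin n) | (A.card + 1) / 2 ≤ (T.filter fun v => ω ∉ openConn v a₀).card} ≤
        δ / (1 - δ) := by
  intro p hp T δ ha₀T _hTA hTcard hδ0 hδ hmarg
  -- a 3-subset of `T`
  have h3 : 3 ≤ T.card := by omega
  obtain ⟨T', hT'T, hT'card⟩ := Finset.exists_subset_card_eq h3
  have ha₀T' : a₀ ∉ T' := fun h => ha₀T (hT'T h)
  -- the inclusion of events
  have hsub : {ω : BondConfig (Fin n) | (A.card + 1) / 2 ≤ (T.filter fun v => ω ∉ openConn v a₀).card} ⊆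
      {ω : BondConfig (Fin n) | 2 ≤ (T'.filter fun v => ω ∉ openConn v a₀).card} := by
    intro ω hω
    simp only [mem_setOf_eq] at hω ⊢
    refine two_le_card_filter_of_subset T T' (fun v => ω ∉ openConn v a₀) hT'T hT'card ?_
    omega
  have hT'b := hM p hp T' δ ha₀T' hT'card hδ0 hδ (fun v hv => hmarg v (hT'T hv))
  have hδδ : δ ≤ δ / (1 - δ) := by
    rw [le_div_iff₀ (by linarith)]
    nlinarith
  exact (measureReal_mono hsub).trans (hT'b.trans hδδ)

/-- **MAJORITY GLUING WITH LOSS `2·max` AT `|A| ∈ {5, 6, 7}` FROM THE MAJORITY-OF-THREE BOUND.**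
HYPOTHESIS `Maj3(a₀)`: for all non-degenerate `p` on `Fin n`, all 3-sets `T' ∌ a₀`, all `0 ≤ δ ≤ 1/2` bounding `μ_p(v ↮ a₀)` on `T'`:
`μ_p(2 ≤ #cut T') ≤ δ`.  CONCLUSION: for every observer `o`, weight function `w` and bound `δ₀ ≥ μ(a ↮ a₀)` on `A` with
`5 ≤ |A| ≤ 7`:  `μ(o ↔ A) − 2δ₀ ≤ μ(o ↔ a₀ ∧ |A| < 2N)` — i.e. `C(6) = C(7) = 2` follows from `maj3` (the cells `(4,3)` and `(5,4)`
of the window; constants-miner 1, gen 4, CANDIDATES §GEN-4 R16). [cite: KozmaNitzan2024, Conj. 1 (p. 3), Conj. 4 (p. 32)] -/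
theorem majorityGluing_two_of_maj3 (w : Sym2 (Fin n) → unitInterval) (A : Finset (Fin n)) (o a₀ : Fin n) (δ₀ : ℝ)
    (ha₀ : a₀ ∈ A) (h5 : 5 ≤ A.card) (h7 : A.card ≤ 7)
    (hM : ∀ (p : Sym2 (Fin n) → unitInterval), (∀ e, 0 < p e ∧ p e < 1) →
      ∀ (T' : Finset (Fin n)) (δ : ℝ), a₀ ∉ T' → T'.card = 3 → 0 ≤ δ → δ ≤ 1 / 2 →
      (∀ v ∈ T', (prodBernoulli p).real (openConn v a₀ : Set (BondConfig (Fin n)))ᶜ ≤ δ) →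
      (prodBernoulli p).real {ω : BondConfig (Fin n) | 2 ≤ (T'.filter fun v => ω ∉ openConn v a₀).card} ≤ δ)
    (hδ₀ : ∀ a ∈ A, (prodBernoulli w).real (openConn a a₀ : Set (BondConfig (Fin n)))ᶜ ≤ δ₀) :
    (prodBernoulli w).real (⋃ a ∈ A, openConn o a) - 2 * δ₀ ≤
      (prodBernoulli w).real {ω : BondConfig (Fin n) | ω ∈ openConn o a₀ ∧
          A.card < 2 * (A.filter fun a => ω ∈ openConn o a).card} :=
  majorityGluing_two_of_weakEKR_at w A o a₀ δ₀ ha₀ (weakEKR_at_of_maj3 A a₀ h5 h7 hM) hδ₀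

/-- **The mined quadratic exchange inequality (C1*) implies the exchange form of `maj3` — pure arithmetic on the eight atoms.**
Dictionary: `pᵢⱼₖ = μ(1[v₁ cut] = i, 1[v₂ cut] = j, 1[v₃ cut] = k)`; (C1*) is `p₀₁₁·p₁₀₁ ≤ p₁₀₀·p₀₁₀`; the hypothesis
`δ₁ ≥ δ₂` reads `p₁₀₀ + p₁₀₁ ≥ p₀₁₀ + p₀₁₁` (the `p₁₁ₖ` atoms cancel); the conclusion `p₀₁₁ ≤ p₁₀₀` is
`μ(H = {v₂,v₃}) ≤ μ(H = {v₁})`, which for `v₁ = argmax δ` is `μ(≥ 2 of 3 cut) ≤ max δ` (CANDIDATES §GEN-4 R16/R17). [folklore] -/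
theorem maj3_exchange_of_c1star (p011 p101 p100 p010 : ℝ) (h100 : 0 ≤ p100) (h010 : 0 ≤ p010)
    (hC1 : p011 * p101 ≤ p100 * p010) (hδ : p010 + p011 ≤ p100 + p101) :
    p011 ≤ p100 := by
  by_cases hA : p100 + p101 ≤ 0
  · nlinarith
  · have hA' : 0 < p100 + p101 := lt_of_not_ge hA
    -- `p011 · (p100 + p101) ≤ p100 · (p010 + p011) ≤ p100 · (p100 + p101)`
    by_contra hlt
    have hlt' : p100 < p011 := lt_of_not_ge hlt
    nlinarith [mul_pos (sub_pos.2 hlt') hA', mul_le_mul_of_nonneg_left hδ h100, hC1]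

end HubOnly

end Summit.CriticalPhenomena.PercolationContinuityZ3.Theorems

end
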